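import Summits.ResolutionOfSingularities.ResolutionOfSingularities.Theorems.ValuativeLuAlphaPTorsorDiscreteDerivationChain

/-!
# The derivation chain with scaling along a quadratic sequence: all dimensions

Helper file for the line `pfaff-line-log-final-forms` of the crux `Valuative.LuAlphaPTorsor`
(item `stmt-ResolutionOfSingularities-0641`), branch `DiscreteAllDim` (the crux along discrete
rank-one valuations, every base dimension), layer L3 (registered helper stub
`discreteAllDim_chain`). It is the dimension-free version of
`discreteSequence_derivationChain` (`ValuativeLuAlphaPTorsorDiscreteDerivationChain.lean`).

Setting: `K` a field, `O ⊆ K` a valuation ring, `R 0 → R 1 → ⋯` a sequence of quadratic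
transforms along `O` of local subrings of `K` (tree `QuadraticTransforms.lean`: `R (i+1)` is
`(R i)[𝔪/x]` localised at the centre of `O`, for a non-zero `x ∈ 𝔪 = 𝔪_{R i}` of largest
value), in the free `π`-chart regime from stage `i₀` on (`π ∈ R i`, `v(π) < 1`). Let `D₀` be a
`ℤ`-derivation of the FIELD `K` mapping `R i₀` into itself. PROVED (`discreteAllDim_chain`):
there is `h : ℕ → K` with `h i₀ = 1` such that for every `i ≥ i₀` the derivation
`Dᵢ := h i • D₀` maps `R i` into `R i`, `0 ≠ h i ∈ R i`, and `h (i+1) = π * h i` if `Dᵢ` is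
transversal at stage `i` — some NON-UNIT `z` of `R i` has `Dᵢ z` a UNIT of `R i` — while
`h (i+1) = h i` otherwise.

The one-step extension (`derivation_mem_of_logarithmic`) is dimension-free: if a derivation `D`
of `K` maps `S` into `S` and non-units of `S` to non-units (or zero), i.e. `D 𝔪_S ⊆ 𝔪_S`
("logarithmic at the closed point"), then `D` maps the quadratic transform
`S₁ = (S[𝔪_S/x])_{𝔪_O ∩ S[𝔪_S/x]}` into itself: for the generators,
`D (y/x) = D y / x - (y/x) (D x / x) ∈ S[𝔪_S/x]` since `D y, D x ∈ 𝔪_S`; the elements `w ∈ S₁`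
with `D w ∈ S₁` form a subring (Leibniz), so it contains `S[𝔪_S/x]`; and it is closed under
quotients with denominators of value `1` (quotient rule). In the non-transversal case this
applies to `h i • D₀`; in the transversal case to `π h i • D₀`, for which
`π h i D₀ z ∈ π R i ⊆ 𝔪` for EVERY `z ∈ R i`. All [folklore] (Seidenberg 1966; Giraud,
Cossart: derivations along quadratic sequences).
-/

set_option linter.dupNamespace false

namespace Summit.ResolutionOfSingularities.ResolutionOfSingularities.Theorems.PfaffLine

open IsLocalRing Literature.AlgebraicGeometry.Resolution

section AllDimStep

variable {K : Type} [Field K]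

/-- For a derivation `D` of the field `K` and a subring `S₁ ⊆ K`: the elements `w ∈ S₁` with
`D w ∈ S₁` form a subring of `K` (Leibniz rule). Stated as an existence so that this helper
file introduces no definitions. [folklore] -/
private theorem exists_subring_mem_iff_derivation_mem (D : Derivation ℤ K K) (S₁ : Subring K) :
    ∃ T : Subring K, ∀ w : K, w ∈ T ↔ w ∈ S₁ ∧ D w ∈ S₁ :=
  ⟨{ carrier := {w | w ∈ S₁ ∧ D w ∈ S₁},
     mul_mem' := fun {a b} ha hb => by
       refine ⟨mul_mem ha.1 hb.1, ?_⟩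
       rw [Derivation.leibniz, smul_eq_mul, smul_eq_mul]
       exact add_mem (mul_mem ha.1 hb.2) (mul_mem hb.1 ha.2),
     one_mem' := ⟨one_mem _, by rw [Derivation.map_one_eq_zero]; exact zero_mem _⟩,
     add_mem' := fun {a b} ha hb => ⟨add_mem ha.1 hb.1, by rw [map_add]; exact add_mem ha.2 hb.2⟩,
     zero_mem' := ⟨zero_mem _, by rw [map_zero]; exact zero_mem _⟩,
     neg_mem' := fun {a} ha => ⟨neg_mem ha.1, by rw [map_neg]; exact neg_mem ha.2⟩ },
    fun _ => Iff.rfl⟩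

/-- The quotient rule `D (a/b) = (b D a - a D b)/b²`: if `a, D a, b, D b ∈ S₁` and `b⁻¹ ∈ S₁`
then `a/b, D (a/b) ∈ S₁`. [folklore] -/
private theorem div_mem_and_derivation_div_mem {D : Derivation ℤ K K} {S₁ : Subring K} {a b : K}
    (ha : a ∈ S₁ ∧ D a ∈ S₁) (hb : b ∈ S₁ ∧ D b ∈ S₁) (hb' : b⁻¹ ∈ S₁) :
    a / b ∈ S₁ ∧ D (a / b) ∈ S₁ := by
  refine ⟨by rw [div_eq_mul_inv]; exact mul_mem ha.1 hb', ?_⟩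
  rw [Derivation.leibniz_div]
  simp only [smul_eq_mul]
  exact mul_mem (pow_mem hb' 2) (sub_mem (mul_mem hb.1 ha.2) (mul_mem ha.1 hb.2))

/-- **One step, dimension-free.** Let `S₁` be the quadratic transform of `S` along `O` and `D` a
derivation of the field `K` which maps `S` into `S` and is logarithmic at the closed point of
`S`: `D z` is zero or a non-unit of `S` for every non-unit `z` of `S`. Then `D` maps `S₁` into
`S₁`. Proof: `S₁ = (S[𝔪/x])_{𝔪_O ∩ S[𝔪/x]}`; the set of `w ∈ S₁` with `D w ∈ S₁` is a subring
containing `S` and the generators `y/x` (`y ∈ 𝔪`), as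
`D (y/x) = D y / x - (y/x) (D x / x)` with `D y, D x ∈ 𝔪`; hence it contains `S[𝔪/x]`, and by
the quotient rule every `a/b` with `a, b ∈ S[𝔪/x]`, `v(b) = 1` (so `b⁻¹ ∈ S₁`). [folklore] -/
private theorem derivation_mem_of_logarithmic {O : ValuationSubring K} {S S₁ : Subring K}
    (h : IsQuadraticTransformAlong O S S₁) (D : Derivation ℤ K K) (hD : ∀ z ∈ S, D z ∈ S)
    (hlog : ∀ z ∈ S, z⁻¹ ∉ S → D z = 0 ∨ (D z)⁻¹ ∉ S) : ∀ z ∈ S₁, D z ∈ S₁ := by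
  obtain ⟨hloc, x, hx, hx0, -, rfl⟩ := h.exists_eq_locAtCentre
  obtain ⟨T, hT⟩ := exists_subring_mem_iff_derivation_mem D (locAtCentre (blowupRing S (x : K)) O)
  have hB : blowupRing S (x : K) ≤ locAtCentre (blowupRing S (x : K)) O := le_locAtCentre _ O
  -- `D` maps `𝔪_S` into `𝔪_S`
  have hlog' : ∀ (y : S) (hy : y ∈ maximalIdeal S), (⟨D y, hD y y.2⟩ : S) ∈ maximalIdeal S := by
    intro y hy
    rw [mem_maximalIdeal_iff_inv_not_mem] at hy ⊢
    rcases hy with hy0 | hyinv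
    · left
      change D (y : K) = 0
      rw [hy0, map_zero]
    · exact hlog y y.2 hyinv
  -- the generators `r ∈ S`
  have h1 : ∀ r ∈ S, r ∈ T := fun r hr =>
    (hT r).mpr ⟨hB (le_blowupRing S _ hr), hB (le_blowupRing S _ (hD r hr))⟩
  -- the generators `y / x`, `y ∈ 𝔪_S`
  have h2 : ∀ y ∈ maximalIdeal S, (y : K) / x ∈ T := fun y hy => by
    refine (hT _).mpr ⟨hB (div_mem_blowupRing _ hy), ?_⟩
    have hx0K : ((x : S) : K) ≠ 0 := fun e => hx0 (Subtype.ext e)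
    have key : D ((y : K) / x) = D y / x - (y : K) / x * (D x / x) := by
      rw [Derivation.leibniz_div]
      simp only [smul_eq_mul]
      field_simp
    rw [key]
    exact hB (sub_mem (div_mem_blowupRing (x : K) (hlog' y hy))
      (mul_mem (div_mem_blowupRing _ hy) (div_mem_blowupRing (x : K) (hlog' x hx))))
  -- hence all of `S[𝔪_S/x]`
  have h3 : blowupRing S (x : K) ≤ T := by
    refine Subring.closure_le.mpr ?_
    rintro z (hz | ⟨y, hy, rfl⟩)
    · exact h1 z hz
    · exact h2 y hy
  -- and all quotients with denominators of value `1`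
  rintro z ⟨a, ha, b, hb, hvb, rfl⟩
  exact (div_mem_and_derivation_div_mem ((hT a).mp (h3 ha)) ((hT b).mp (h3 hb))
    (inv_mem_locAtCentre (hB hb) hvb)).2

/-- The same for the scaled derivation `c • D₀`: if `c D₀ (S) ⊆ S` and `c D₀ z` is zero or a
non-unit of `S` for every non-unit `z` of `S`, then `c D₀ (S₁) ⊆ S₁`. [folklore] -/
private theorem mul_derivation_mem_of_logarithmic {O : ValuationSubring K} {S S₁ : Subring K}
    (h : IsQuadraticTransformAlong O S S₁) (D₀ : Derivation ℤ K K) (c : K)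
    (hc : ∀ z ∈ S, c * D₀ z ∈ S)
    (hlog : ∀ z ∈ S, z⁻¹ ∉ S → c * D₀ z = 0 ∨ (c * D₀ z)⁻¹ ∉ S) :
    ∀ z ∈ S₁, c * D₀ z ∈ S₁ := fun z hz => by
  have key := derivation_mem_of_logarithmic h (c • D₀)
    (fun w hw => by rw [Derivation.smul_apply, smul_eq_mul]; exact hc w hw)
    (fun w hw hwinv => by rw [Derivation.smul_apply, smul_eq_mul]; exact hlog w hw hwinv) z hz
  rwa [Derivation.smul_apply, smul_eq_mul] at key

/-- A non-zero element of value `< 1` has its inverse outside every subring of `O`. [folklore] -/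
private theorem inv_not_mem_of_valuation_lt_one {O : ValuationSubring K} {S : Subring K}
    (hS : S ≤ O.toSubring) {π : K} (hπ0 : π ≠ 0) (hπ1 : O.valuation π < 1) : π⁻¹ ∉ S := by
  intro hmem
  have h1 : O.valuation π⁻¹ ≤ 1 := (O.valuation_le_one_iff _).mpr (hS hmem)
  rw [map_inv₀, inv_le_one₀ (pos_iff_ne_zero.mpr ((map_ne_zero _).mpr hπ0))] at h1
  exact not_lt.mpr h1 hπ1

end AllDimStep

/-- **Registered stub `discreteAllDim_chain`** (branch `DiscreteAllDim`, layer L3): the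
derivation chain with scaling, every base dimension. In the free `π`-chart regime from stage
`i₀` of the quadratic sequence `R` along `O'` (`π` of value `< 1`), a derivation
`D₀ ∈ Der_ℤ(K')` mapping `R i₀` into itself gives `h : ℕ → K'`, `h i₀ = 1`, with
`0 ≠ h i ∈ R i`, `h i • D₀ (R i) ⊆ R i`, and `h (i+1) = π h i` if `h i • D₀` is transversal at
stage `i` (some non-unit `z` of `R i` has `h i D₀ z` a unit of `R i`), `h (i+1) = h i`
otherwise. Construction by recursion; the step is `derivation_mem_of_logarithmic` applied to
`h i • D₀` (non-transversal case: `h i D₀` maps non-units to non-units or zero) or to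
`π h i • D₀` (transversal case: `π h i D₀ z ∈ π R i ⊆ 𝔪` for all `z ∈ R i`). The hypotheses
`D₀ π = 0`, domination of `R 0` and the division clause of the free regime are part of the
registered interface but not used. [folklore] -/
theorem discreteAllDim_chain :
    ∀ (K' : Type) [Field K'] (O' : ValuationSubring K') (R : ℕ → Subring K') (π : K') (i₀ : ℕ) (D₀ : Derivation ℤ K' K'), Literature.AlgebraicGeometry.Resolution.SubringDominates (R 0) O'.toSubring → (∀ i, Literature.AlgebraicGeometry.Resolution.IsQuadraticTransformAlong O' (R i) (R (i + 1))) → π ≠ 0 → O'.valuation π < 1 → (∀ i : ℕ, i₀ ≤ i → π ∈ R i ∧ ∀ z : K', z ∈ R i → z⁻¹ ∉ R i → z / π ∈ R (i + 1)) → D₀ π = 0 → (∀ z : K', z ∈ R i₀ → D₀ z ∈ R i₀) → ∃ h : ℕ → K', h i₀ = 1 ∧ ∀ i : ℕ, i₀ ≤ i → h i ≠ 0 ∧ h i ∈ R i ∧ (∀ z : K', z ∈ R i → h i * D₀ z ∈ R i) ∧ ((∃ z : K', z ∈ R i ∧ z⁻¹ ∉ R i ∧ h i * D₀ z ≠ 0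 ∧ (h i * D₀ z)⁻¹ ∈ R i) → h (i + 1) = π * h i) ∧ ((¬ ∃ z : K', z ∈ R i ∧ z⁻¹ ∉ R i ∧ h i * D₀ z ≠ 0 ∧ (h i * D₀ z)⁻¹ ∈ R i) → h (i + 1) = h i) := by
  intro K _ O R π i₀ D₀ _h0 hstep hπ0 hπ1 hfree _hD₀π hD₀
  classical
  -- the recursion defining `h (i₀ + n) = g n`
  obtain ⟨g, hg0, hgs⟩ : ∃ g : ℕ → K, g 0 = 1 ∧ ∀ n, g (n + 1) =
      if ∃ z : K, z ∈ R (i₀ + n) ∧ z⁻¹ ∉ R (i₀ + n) ∧ g n * D₀ z ≠ 0 ∧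
          (g n * D₀ z)⁻¹ ∈ R (i₀ + n) then π * g n else g n :=
    ⟨fun n => Nat.rec (motive := fun _ => K) 1
      (fun n c => if ∃ z : K, z ∈ R (i₀ + n) ∧ z⁻¹ ∉ R (i₀ + n) ∧ c * D₀ z ≠ 0 ∧
          (c * D₀ z)⁻¹ ∈ R (i₀ + n) then π * c else c) n, rfl, fun _ => rfl⟩
  have hπinv : ∀ i, π⁻¹ ∉ R i := fun i =>
    inv_not_mem_of_valuation_lt_one (hstep i).source_le hπ0 hπ1
  -- the inductive invariant
  have key : ∀ n : ℕ, g n ≠ 0 ∧ g n ∈ R (i₀ + n) ∧ ∀ z ∈ R (i₀ + n), g n * D₀ z ∈ R (i₀ + n) := by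
    intro n
    induction n with
    | zero =>
      rw [hg0, Nat.add_zero]
      exact ⟨one_ne_zero, one_mem _, fun z hz => by rw [one_mul]; exact hD₀ z hz⟩
    | succ n ih =>
      obtain ⟨hg0', hgR, hgD⟩ := ih
      obtain ⟨hπR, -⟩ := hfree (i₀ + n) (Nat.le_add_right _ _)
      have hst : IsQuadraticTransformAlong O (R (i₀ + n)) (R (i₀ + (n + 1))) := hstep (i₀ + n)
      rw [hgs n]
      split_ifs with hT
      · -- transversal: scale by `π`; `π g D₀ z ∈ π R ⊆ 𝔪` for every `z ∈ R (i₀ + n)`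
        refine ⟨mul_ne_zero hπ0 hg0', hst.le (mul_mem hπR hgR), ?_⟩
        refine mul_derivation_mem_of_logarithmic hst D₀ (π * g n) (fun w hw => ?_)
          (fun w hw _ => ?_)
        · rw [mul_assoc]
          exact mul_mem hπR (hgD w hw)
        · by_cases hw0 : g n * D₀ w = 0
          · left
            rw [mul_assoc, hw0, mul_zero]
          · refine Or.inr fun hinv => hπinv (i₀ + n) ?_
            have e : g n * D₀ w * (π * g n * D₀ w)⁻¹ = π⁻¹ := by
              rw [mul_assoc π, mul_inv, mul_comm π⁻¹, ← mul_assoc, mul_inv_cancel₀ hw0, one_mul]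
            rw [← e]
            exact mul_mem (hgD w hw) hinv
      · -- logarithmic: keep `h`
        refine ⟨hg0', hst.le hgR, ?_⟩
        refine mul_derivation_mem_of_logarithmic hst D₀ (g n) hgD fun w hw hwinv => ?_
        by_cases hw0 : g n * D₀ w = 0
        · exact Or.inl hw0
        · exact Or.inr fun hinv => hT ⟨w, hw, hwinv, hw0, hinv⟩
  refine ⟨fun i => g (i - i₀), ?_, fun i hi => ?_⟩
  · show g (i₀ - i₀) = 1
    rw [Nat.sub_self, hg0]
  obtain ⟨n, rfl⟩ := Nat.exists_eq_add_of_le hi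
  have e1 : i₀ + n - i₀ = n := by omega
  have e2 : i₀ + n + 1 - i₀ = n + 1 := by omega
  simp only [e1, e2]
  obtain ⟨hg0', hgR, hgD⟩ := key n
  exact ⟨hg0', hgR, hgD, fun hT => by rw [hgs n, if_pos hT], fun hT => by rw [hgs n, if_neg hT]⟩

end Summit.ResolutionOfSingularities.ResolutionOfSingularities.Theorems.PfaffLine
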